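import Mathlib
import Literature.NumberTheory.LFunctions.Zhang2022.TypedSection17Identities
import Literature.NumberTheory.LFunctions.Zhang2022.Section17SplittingIdentities
import HarnessLib

/-!
# Zhang (2022) §17, the `I₄⁻` inner chain in the χ-TWISTED reading (RT16-int-1): the exact
# identities §17.u015-χ, §17.u019-χ, §17.u020-χ, kernel-checked

Topic `Literature/NumberTheory/LFunctions/Zhang2022` (Landau–Siegel audit tree; verdict-neutral).
Y. Zhang, *Discrete mean estimates and the Landau–Siegel zero*, arXiv:2211.02515v1 (2022)
[Zhang2022LandauSiegel] — **an unrefereed manuscript under adjudication; nothing in this file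
asserts or denies its Theorems 1–2, and no claim about Landau–Siegel zeros is made.** ZHANG-L
discharge lane, WP16 helper under the leaf `Typed.Section17.Eq17_9Rel` (§17 (17.7)–(17.9), pp. 97–98).

The typed §17 `I₄⁻` block (`TypedSection17.lean`, nodes `Step17_u015`, `Eq17_8`, `Step17_u019`–`u021`,
`u023`, `u024`) is transcribed AS PRINTED with the χ-free coefficient `b ∗ ν₁*`
(`Typed.Section17.bConvNuOne`), whereas `B(s,ψ) = Σ_n b(n)ψχ(n)n^{−s}` ((15.1); the tree's
`Typed.Section17.Bpoly_eq_LSeries`), so the honest `ψ`-coefficient sequence of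
`B(s,ψ)G(s,ψ)N(s+β₂,ψ)N(s+β₃,ψ)` is `(bχ) ∗ ν₁*`. WP16's internal re-type RT16-int-1 (WP16-PLAN §1.6,
referee finding F17-χ) therefore discharges the inner chain over the TWISTED coefficient, spelled
INLINE as `LSeries.convolution (fun n => bcoef D n * χ n) (nuOneStar c′ χ)` (no new definition, no new
claim node). This file proves the three EXACT IDENTITIES of that chain:

* `step17_u015_chi` — §17.u015 in its true form: for every `ψ ∈ Ψ` and every `s`,
  `B(s,ψ)G(s,ψ)N(s+β₂,ψ)N(s+β₃,ψ) = Σ_n ((bχ)∗ν₁*)(n)ψ(n)n^{−s}` [Z22 p.97, tex L4797]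
  (from `Bpoly_eq_LSeries`, `step17_u014_holds` and multiplication of `ψ`-twisted `L`-series);
* `step17_u019_chi` — §17.u019 [Z22 p.98, tex L4817]: "`Σ_n (b∗ν₁*)(n)ϱ*(n)/n =
  Σ_{l<D⁴} (ν(l)/l) Σ_m (b∗ν₁*)(lm)κ̄₂(m)/m`" with `b ↦ bχ` (a rearrangement of a finitely supported
  double sum; `ϱ* = (ν·[<D⁴]) ∗ κ̄₂` is the tree's `varrho17`);
* `step17_u020_chi` — §17.u020 [Z22 p.98, tex L4821]: "the inner sum is equal to
  `Σ_{l=l₁l₂} Σ_{m₁} Σ_{(m₂,l₁)=1} b(l₁m₁)ν₁*(l₂m₂)κ̄₂(m₁m₂)/(m₁m₂)`" with `b ↦ bχ` (the re-indexing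
  `a = l₁m₁, c = l₂m₂, m = m₁m₂` of the pairs `ac = lm`, `l₂ = gcd(c,l)`, which is a bijection exactly
  because of the side condition `(m₂,l₁) = 1`).

Division of labour (lane librarian zl-lib-2, 2026-08-26T23:57Z): the two rearrangements for
ARBITRARY finitely supported coefficients, and the literal χ-free nodes `Step17_u019/u020` BY NAME, are
the sibling file `Section17SplittingIdentities` (`tsum_mul_convolution_indicator_div_eq_sum`,
`tsum_convolution_mul_div_eq_sum_divisorsAntidiagonal`); u019-χ/u020-χ below are their instances at
`f = bχ`, and u015-χ is the `L`-series product identity. The finite supports of `bχ` and `ν₁*` used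
here hold for EVERY `D` (`bcoef_eq_zero_of_sqrtP_mul_max_le`, `nuOneStar_eq_zero_of_le` of
`TypedSection17NuStarBound`), so the three identities carry no largeness hypothesis. Theorems only;
standard axioms. WHAT THIS IS NOT: the estimate §17.u021 ("drop the terms with `m₂ > 1` or
`(m₁,𝔮) > 1` with an acceptable error"), (17.8), u024, or any leaf — those remain with their owners
(WP16-PLAN §3).

## References

* Y. Zhang, arXiv:2211.02515v1 (2022), §17 pp. 97–98 (u015, u019, u020); §15 (15.1) p. 79.
  [cite: Zhang2022LandauSiegel, §17 pp.97–98]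
-/

noncomputable section

open Complex Real ComplexConjugate Finset
open scoped LSeries.notation

namespace Literature.NumberTheory.LFunctions.Zhang2022.Typed.Section17

open Literature.NumberTheory.LFunctions.Zhang2022
open Literature.NumberTheory.LFunctions.Zhang2022.Skeleton

/-! ## The χ-twisted inner chain of §17 (RT16-int-1): u015-χ, u019-χ, u020-χ -/

section Chi

variable (c' : ℝ) {D : ℕ} [NeZero D] (χ : DirichletCharacter ℂ D)

omit [NeZero D] in
/-- The twisted coefficient `(bχ)(n) = b(n)χ(n)` vanishes from `P^{1/2}max(P₂,P₃)` on (every `D`).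
[cite: Zhang2022LandauSiegel, §15 (15.2) p.79] -/
theorem bcoef_mul_chi_eq_zero_of_le {n : ℕ}
    (hn : ⌈bigP D ^ (1 / 2 : ℝ) * max (Skeleton.P2 D) (Skeleton.P3 D)⌉₊ ≤ n) :
    bcoef D n * χ (n : ZMod D) = 0 := by
  rw [bcoef_eq_zero_of_sqrtP_mul_max_le (le_trans (Nat.le_ceil _) (by exact_mod_cast hn)), zero_mul]

/-- **§17.u015 in the χ-twisted reading (RT16-int-1), PROVED**: for every `ψ ∈ Ψ` and every `s`,
`B(s,ψ)G(s,ψ)N(s+β₂,ψ)N(s+β₃,ψ) = Σ_n ((bχ)∗ν₁*)(n)ψ(n)n^{−s}` — the honest form of "so that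
`B(s,ψ)G(s,ψ)N(s+β₂,ψ)N(s+β₃,ψ) = Σ_n (b∗ν₁*)(n)ψ(n)n^{−s}`" (§17 p. 97; `B` carries `χ` by (15.1)).
All four factors are finite Dirichlet polynomials, so the identity holds at every `s`.
[cite: Zhang2022LandauSiegel, §17 u015 p.97] -/
theorem step17_u015_chi (x : Chr D) (s : ℂ) :
    Bpoly χ x s * Gpoly χ x s * Nchar D (psiFn x) (s + beta2 c' D) *
        Nchar D (psiFn x) (s + beta3 c' D) =
      ∑' n : ℕ, ((fun n => bcoef D n * χ (n : ZMod D)) ⍟ nuOneStar c' χ) n *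
        x.ψ (n : ZMod x.p) * (n : ℂ) ^ (-s) := by
  -- `B = L((bχ)·ψ)`, `G·N·N = L(ν₁*·ψ)` (u014), and the product of two `ψ`-twisted `L`-series
  have hB : Bpoly χ x s = LSeries (fun n => (bcoef D n * χ (n : ZMod D)) * psiFn x n) s := by
    rw [Bpoly_eq_LSeries x χ s]
    congr 1
    funext n
    simp only [pc, psiFn]
    ring
  have h14 := step17_u014_holds c' χ x s
  have hGNN : Gpoly χ x s * Nchar D (psiFn x) (s + beta2 c' D) * Nchar D (psiFn x) (s + beta3 c' D) =
      LSeries (fun n => nuOneStar c' χ n * psiFn x n) s := by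
    rw [h14]
    refine tsum_congr fun n => ?_
    rcases eq_or_ne n 0 with rfl | hn
    · simp [LSeries.term, nuOneStar]
    · rw [LSeries.term_of_ne_zero hn, psiFn, div_eq_mul_inv, Complex.cpow_neg]
  -- summability (finite supports)
  have hsb : LSeriesSummable (fun n => (bcoef D n * χ (n : ZMod D)) * psiFn x n) s := by
    refine summable_of_ne_finset_zero
      (s := Finset.range ⌈bigP D ^ (1 / 2 : ℝ) * max (Skeleton.P2 D) (Skeleton.P3 D)⌉₊) fun n hn => ?_
    have hn' : ⌈bigP D ^ (1 / 2 : ℝ) * max (Skeleton.P2 D) (Skeleton.P3 D)⌉₊ ≤ n := by simpa using hn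
    rcases eq_or_ne n 0 with rfl | h0
    · simp [LSeries.term]
    · rw [LSeries.term_of_ne_zero h0, bcoef_mul_chi_eq_zero_of_le χ hn', zero_mul, zero_div]
  have hsn : LSeriesSummable (fun n => nuOneStar c' χ n * psiFn x n) s := by
    refine summable_of_ne_finset_zero
      (s := Finset.range ⌈4 * ((D : ℝ) ^ 4 + 1) * bigT D ^ 4⌉₊) fun n hn => ?_
    have hn' : ⌈4 * ((D : ℝ) ^ 4 + 1) * bigT D ^ 4⌉₊ ≤ n := by simpa using hn
    rcases eq_or_ne n 0 with rfl | h0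
    · simp [LSeries.term]
    · rw [LSeries.term_of_ne_zero h0, nuOneStar_eq_zero_of_ceil_le c' χ hn', zero_mul, zero_div]
  -- twisting by the completely multiplicative `ψ` commutes with convolution
  have htwist : (fun n => (bcoef D n * χ (n : ZMod D)) * psiFn x n) ⍟
      (fun n => nuOneStar c' χ n * psiFn x n) =
      fun n => ((fun n => bcoef D n * χ (n : ZMod D)) ⍟ nuOneStar c' χ) n * psiFn x n := by
    rw [LSeries.convolution_def, LSeries.convolution_def]
    ext n
    rw [Finset.sum_mul]
    refine Finset.sum_congr rfl fun p hp => ?_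
    have hpn : p.1 * p.2 = n := (Nat.mem_divisorsAntidiagonal.mp hp).1
    have hψ : psiFn x n = psiFn x p.1 * psiFn x p.2 := by
      rw [← hpn]; simp [psiFn, Nat.cast_mul, map_mul]
    rw [hψ]; ring
  calc Bpoly χ x s * Gpoly χ x s * Nchar D (psiFn x) (s + beta2 c' D) *
        Nchar D (psiFn x) (s + beta3 c' D)
      = Bpoly χ x s * (Gpoly χ x s * Nchar D (psiFn x) (s + beta2 c' D) *
          Nchar D (psiFn x) (s + beta3 c' D)) := by ring
    _ = LSeries (fun n => (bcoef D n * χ (n : ZMod D)) * psiFn x n) s *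
          LSeries (fun n => nuOneStar c' χ n * psiFn x n) s := by rw [hB, hGNN]
    _ = LSeries (fun n => ((fun n => bcoef D n * χ (n : ZMod D)) ⍟ nuOneStar c' χ) n * psiFn x n) s := by
          rw [← LSeries_convolution' hsb hsn, htwist]
    _ = ∑' n : ℕ, ((fun n => bcoef D n * χ (n : ZMod D)) ⍟ nuOneStar c' χ) n *
          x.ψ (n : ZMod x.p) * (n : ℂ) ^ (-s) := by
          rw [LSeries]
          refine tsum_congr fun n => ?_
          rcases eq_or_ne n 0 with rfl | hn
          · simp [LSeries.term]
          · rw [LSeries.term_of_ne_zero hn, psiFn, div_eq_mul_inv, Complex.cpow_neg]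

omit [NeZero D] in
/-- A COMMON index `N_χ(D) := max(⌈P^{1/2}max(P₂,P₃)⌉, ⌈4(D⁴+1)T⁴⌉)` from which both `bχ` and `ν₁*`
vanish, for EVERY `D` (no `𝓛 ≥ 3` needed; cf. `exists_common_support` of the sibling file).
[cite: Zhang2022LandauSiegel, §17 u021 p.98] -/
theorem bcoefChi_nuOneStar_support :
    (∀ n, max ⌈bigP D ^ (1 / 2 : ℝ) * max (Skeleton.P2 D) (Skeleton.P3 D)⌉₊
        ⌈4 * ((D : ℝ) ^ 4 + 1) * bigT D ^ 4⌉₊ ≤ n → bcoef D n * χ (n : ZMod D) = 0) ∧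
      ∀ n, max ⌈bigP D ^ (1 / 2 : ℝ) * max (Skeleton.P2 D) (Skeleton.P3 D)⌉₊
        ⌈4 * ((D : ℝ) ^ 4 + 1) * bigT D ^ 4⌉₊ ≤ n → nuOneStar c' χ n = 0 :=
  ⟨fun _ h => bcoef_mul_chi_eq_zero_of_le χ (le_trans (le_max_left _ _) h),
    fun _ h => nuOneStar_eq_zero_of_ceil_le c' χ (le_trans (le_max_right _ _) h)⟩

omit [NeZero D] in
/-- The twisted convolution `(bχ)∗ν₁*` vanishes from `N_χ(D)²` on (every `D`; cf. the sharper
"supported on `n < PT⁻²`" of §17 p. 98 for `D` large, `Typed.Section17.bConvNuOne_eq_zero_of_le`).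
[cite: Zhang2022LandauSiegel, §17 (17.8) p.98] -/
theorem bcoefChi_conv_nuOneStar_eq_zero_of_le {n : ℕ}
    (hn : max ⌈bigP D ^ (1 / 2 : ℝ) * max (Skeleton.P2 D) (Skeleton.P3 D)⌉₊
        ⌈4 * ((D : ℝ) ^ 4 + 1) * bigT D ^ 4⌉₊ *
      max ⌈bigP D ^ (1 / 2 : ℝ) * max (Skeleton.P2 D) (Skeleton.P3 D)⌉₊
        ⌈4 * ((D : ℝ) ^ 4 + 1) * bigT D ^ 4⌉₊ ≤ n) :
    ((fun n => bcoef D n * χ (n : ZMod D)) ⍟ nuOneStar c' χ) n = 0 :=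
  convolution_eq_zero_of_le (bcoefChi_nuOneStar_support c' χ).1 (bcoefChi_nuOneStar_support c' χ).2 hn

omit [NeZero D] in
/-- **§17.u019 in the χ-twisted reading (RT16-int-1), PROVED**: "We have
`Σ_n (b∗ν₁*)(n)ϱ*(n)/n = Σ_{l<D⁴} (ν(l)/l) Σ_m (b∗ν₁*)(lm)κ̄₂(m)/m`" (§17 p. 98) with `b ↦ bχ`
(`ϱ* = Typed.Section17.varrho17 = (ν·[<D⁴]) ∗ κ̄₂`, `κ̄₂ = kappa2bar`); an exact rearrangement of a
finitely supported double sum, valid for every `D` and `c′` (instance `f = bχ` of the sibling file's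
`tsum_mul_convolution_indicator_div_eq_sum`; the literal χ-free node is `step17_u019_holds` there).
[cite: Zhang2022LandauSiegel, §17 u019 p.98] -/
theorem step17_u019_chi :
    ∑' n : ℕ, ((fun n => bcoef D n * χ (n : ZMod D)) ⍟ nuOneStar c' χ) n * varrho17 c' χ n / (n : ℂ) =
      ∑ l ∈ Finset.Ico 1 (D ^ 4), nu χ l / (l : ℂ) *
        ∑' m : ℕ, ((fun n => bcoef D n * χ (n : ZMod D)) ⍟ nuOneStar c' χ) (l * m) *
          kappa2bar c' D m / (m : ℂ) := by
  rw [varrho17]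
  exact tsum_mul_convolution_indicator_div_eq_sum _ (nu χ) (kappa2bar c' D) (D ^ 4)
    (fun _ h => bcoefChi_conv_nuOneStar_eq_zero_of_le c' χ h)

omit [NeZero D] in
/-- **§17.u020 in the χ-twisted reading (RT16-int-1), PROVED**: for every `l ≥ 1`, "the inner sum is
equal to `Σ_{l=l₁l₂} Σ_{m₁} Σ_{(m₂,l₁)=1} b(l₁m₁)ν₁*(l₂m₂)κ̄₂(m₁m₂)/(m₁m₂)`" (§17 p. 98) with `b ↦ bχ`:
`Σ_m ((bχ)∗ν₁*)(lm)κ̄₂(m)/m = Σ_{(l₁,l₂), l₁l₂=l} Σ_{m₁}Σ_{m₂} [(m₂,l₁)=1] b(l₁m₁)χ(l₁m₁)ν₁*(l₂m₂)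
κ̄₂(m₁m₂)/(m₁m₂)`; an exact re-indexing, valid for every `D` and `c′` (instance `f = bχ` of the
sibling file's `tsum_convolution_mul_div_eq_sum_divisorsAntidiagonal`; literal node: `step17_u020_holds`).
[cite: Zhang2022LandauSiegel, §17 u020 p.98] -/
theorem step17_u020_chi (l : ℕ) (hl : 1 ≤ l) :
    ∑' m : ℕ, ((fun n => bcoef D n * χ (n : ZMod D)) ⍟ nuOneStar c' χ) (l * m) *
        kappa2bar c' D m / (m : ℂ) =
      ∑ q ∈ l.divisorsAntidiagonal, ∑' m₁ : ℕ, ∑' m₂ : ℕ,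
        if Nat.Coprime m₂ q.1 then
          bcoef D (q.1 * m₁) * χ ((q.1 * m₁ : ℕ) : ZMod D) * nuOneStar c' χ (q.2 * m₂) *
            kappa2bar c' D (m₁ * m₂) / ((m₁ : ℂ) * m₂)
        else 0 :=
  tsum_convolution_mul_div_eq_sum_divisorsAntidiagonal (fun n => bcoef D n * χ (n : ZMod D))
    (nuOneStar c' χ) (kappa2bar c' D) (bcoefChi_nuOneStar_support c' χ).1
    (bcoefChi_nuOneStar_support c' χ).2 hl

end Chi

end Literature.NumberTheory.LFunctions.Zhang2022.Typed.Section17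

end
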